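import Literature.Topology.FourManifolds.LinkLeeStates
import Literature.Topology.FourManifolds.KhResolutionsDichotomyProofs
import HarnessLib

/-!
# `d² = 0` for the Khovanov complex of a link Gauss diagram, from merge-or-split (layer T1a)

Port to the link tower (`LinkGaussDiagrams` D1 → `LinkKhResolutions` D2a → `LinkKhComplex` D2b
→ `LinkLeeStates` D2c) of the knot tower's `KhComplexFaceProofs`
(`GaussDiagram.khovanovD_comp_khovanovD_of_isMergeAt_or_isSplitAt`): the planarity-free half
of Khovanov (2000), Prop. 8 for Gauss diagrams of oriented LINKS.

* `khovanovD_comp_khovanovD_of_isMergeAt_or_isSplitAt`: if at every `0`-smoothed chord of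
  every state of the link Gauss diagram `L` the flip `0 → 1` is a merge or a split (the
  dichotomy hypothesis `hms`; no one-to-one bifurcation), then
  `khovanovD R h t (i + 1) (i + 2) ∘ khovanovD R h t i (i + 1) = 0` for every commutative ring
  `R`, every Frobenius system `(h, t)` and every `i`.
* The statewise lemmas behind it: `sum_incidence_mul_incidence_face` (a two-dimensional face
  of the cube anticommutes) and `sum_incidence_mul_incidence_eq_zero` (every entry of `d²`
  vanishes).
* Consequences for D2b: `khovanovD_comp_khovanovD_pred_of_isMergeAt_or_isSplitAt`
  (`dᵢ ∘ dᵢ₋₁ = 0`), `range_khovanovD_le_ker` (`im dᵢ₋₁ ≤ ker dᵢ`), the hypothesis-`hd`-free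
  packages `frobeniusComplexOfDichotomy`, `leeComplexOfDichotomy` of D2b's `frobeniusComplex` /
  `leeComplex`, and the comparison `nonempty_iso_frobeniusHomology_homology` of D2b's concrete
  `frobeniusHomology = ker dᵢ ⧸ (im dᵢ₋₁ ⊓ ker dᵢ)` with the categorical homology of
  `frobeniusComplex` (for every `hd`; port of the knot tower's
  `nonempty_iso_frobeniusHomology_homology_holds`, `KhComplexProofs`), specialised to
  merge-or-split in `nonempty_iso_frobeniusHomology_homology_of_isMergeAt_or_isSplitAt`.
* Sanity and transport: the crossingless diagrams `unknots k` satisfy `hms` vacuously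
  (`isMergeAt_or_isSplitAt_unknots`, `khovanovD_comp_khovanovD_unknots`); a knot diagram `G`
  with Gauss's parity condition `hpar` gives a link diagram `ofGaussDiagram G` satisfying `hms`
  (`isMergeAt_or_isSplitAt_ofGaussDiagram`, by D2a's `isMergeAt_ofGaussDiagram_iff` /
  `isSplitAt_ofGaussDiagram_iff` and the knot tower's
  `GaussDiagram.isMergeAt_or_isSplitAt_of_overPos_mod_two_ne`), hence `d² = 0` there
  (`khovanovD_comp_khovanovD_ofGaussDiagram`).

## The proof (as in the knot tower)

An entry of `d²` is `∑ₓ ⟨d s, x⟩ ⟨d x, s'⟩` over enhanced states `x`; it vanishes termwise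
unless `s'.state` is `s.state` with two `0`-smoothings `i ≠ j` flipped, and then it is the sum
of the contributions of the two paths `σ → σ[i ↦ 1] → σ[i ↦ 1][j ↦ 1]` and
`σ → σ[j ↦ 1] → σ[j ↦ 1][i ↦ 1]` of a face of the cube. Each incidence number is a Koszul
sign times an abstract edge value of `KhFaces` (`incidence_eq_edgeVal`, through D2b's
`incidence_eq_mergeInc` / `incidence_eq_splitInc`); summing over the enhanced states with a
fixed state is summing over labellings of its circles (`sum_ite_state_eq`); the unsigned face
sums agree by the abstract face theorem `KhFace.face_comm` of `KhFaces` (associativity,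
coassociativity, the Frobenius identity and far-commutativity of `A = R[X]/(X² - hX - t)`,
REUSED, not re-proved), and the Koszul signs of the two paths are opposite
(`edgeSign_mul_edgeSign_update`).

The only geometric input of `KhFace.face_comm` is the **surgery relation** `KhFace.Surg` along
each edge: the circles after a merge are the circles before it with the two circles through
the local strands `arcIn (overPos i)`, `arcOut (overPos i)` united, and dually for a split.
In the knot tower this comes from the edge-trade analysis of `KhFlipReach`; here it is derived
in a few lines (`surg_of_eq_off`) from the circle bookkeeping of D2c (`adj_of_eq_off`: the
state graphs of two states agreeing off chord `i` differ only by edges between the four arcs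
at chord `i`; `circleOf_eq_of_atChord`: these four arcs lie on the circles of the two local
strands) — valid for every pair of states agreeing off one chord in which the two strands are
separated in the first and joined in the second (`IsMergeAt.surg`, `IsSplitAt.surg`).

## What is ported and what is reused

Ported from `KhComplexFaceProofs` (same names, `G ↦ L`): `IsMergeAt.surg`, `IsSplitAt.surg`,
`kindAt`, `edgeOK_kindAt`, `exists_of_incidence_ne_zero`, `incidence_eq_edgeVal`,
`card_filter_lt_update`, `edgeSign_mul_edgeSign_update`, `ofLab`, `stateEquivLab`,
`sum_ite_state_eq`, `sum_incidence_mul_incidence_face`, `sum_incidence_mul_incidence_eq_zero`,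
`khovanovD_comp_khovanovD_of_isMergeAt_or_isSplitAt`; from `KhComplexProofs`:
`frobeniusComplex_d`, `nonempty_iso_frobeniusHomology_homology`. Reused as they stand (the
knot files `KhComplexFaceProofs`, `KhFlipReach` are NOT imported): the whole abstract face
algebra of `KhFaces` (`KhFace.Surg`, `Lab`, `Kind`, `edgeVal`, `EdgeOK`, `face_comm`), D2b's
`incidence_eq_mergeInc/splitInc`, `incidence_of_not_flip`, `homDegree_eq_of_incidence_ne_zero`,
`khovanovD_eq_zero_of_ne`, D2c's `adj_of_eq_off`, `circleOf_eq_of_atChord`,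
`IsMergeAt.circleOf_update_arcIn`, D2a's `IsMergeAt.not_isSplitAt` and correspondence lemmas,
and the knot tower's parity ⇒ dichotomy theorem
`GaussDiagram.isMergeAt_or_isSplitAt_of_overPos_mod_two_ne`. The knot tower's
`khovanovD_comp_khovanovD_of_dichotomy` (consuming the named fact
`isMergeAt_or_isSplitAt_of_hasGaussDiagram`) has no link counterpart yet: there is no
realisability predicate for link Gauss diagrams in the tree, so the dichotomy stays an
explicit hypothesis `hms` (discharged here for `unknots k` and for `ofGaussDiagram G` under
Gauss parity).

## Sources

* M. Khovanov, *A categorification of the Jones polynomial*, Duke Math. J. 101 (2000) 359–426,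
  §3.3 (skew-commutative cubes), §4.2, Prop. 8 (the cube `V_D` commutes).
  [cite: Khovanov2000, §4.2 Prop. 8]
* D. Bar-Natan, *On Khovanov's categorification of the Jones polynomial*, Algebr. Geom. Topol. 2
  (2002) 337–370, §3.1 (merges and splits), §3.2 (faces commute; the signs make them
  anticommute). [cite: BarNatan2002, §3.2]
* O. Viro, *Khovanov homology, its definitions and ramifications*, Fund. Math. 184 (2004)
  317–342, §5.2 (incidence numbers; Morse modifications along an edge). [cite: Viro2004, §5.2]
* V. O. Manturov, *Khovanov homology for virtual knots with arbitrary coefficients*, Izv. Math.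
  71 (2007) 967–999 (why merge-or-split is needed). [cite: Manturov2007]
* M. Khovanov, op. cit., §7 (the homology groups of the cube complex). [cite: Khovanov2000, §7]
* E. S. Lee, *An endomorphism of the Khovanov invariant*, Adv. Math. 197 (2005) 554–586, §4.
  [cite: Lee2005, §4]
* Mathlib: `Matrix.toLin'_mul`, `Matrix.mul_apply`, `Finset.sum_subtype`, `Fintype.sum_equiv`,
  `Function.update_comm`, `SimpleGraph.ConnectedComponent.exact/sound`,
  `LinearMap.range_le_ker_iff`, `CochainComplex.of_d`/`of_d_ne`,
  `HomologicalComplex.homologyIsoSc'`, `ShortComplex.moduleCatHomologyIso`,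
  `Submodule.quotEquivOfEq`.
-/

open Function Finset

noncomputable section

namespace Literature.Topology.FourManifolds

namespace LinkGaussDiagram

variable (L : LinkGaussDiagram)

/-! ## The surgery relation along an edge of the cube -/

/-- **Monotonicity of circles between states agreeing off one chord.** If the states `σ`, `τ`
agree off chord `i` and the two local strands `arcIn (overPos i)`, `arcOut (overPos i)` lie on
one circle of `τ`, then arcs on a common circle of `σ` lie on a common circle of `τ` (the state
graphs differ only by edges among the four arcs at chord `i`, `adj_of_eq_off`, all of which lie
on the circles of the two strands, `circleOf_eq_of_atChord`). Bar-Natan (2002), §3.1 (a flip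
changes no circle away from the crossing). [cite: BarNatan2002, §3.1] -/
theorem circleOf_eq_of_eq_off {σ τ : L.State} {i : Fin L.n} (hστ : ∀ j, j ≠ i → τ j = σ j)
    (hτ : L.circleOf τ (L.arcIn (L.overPos i)) = L.circleOf τ (L.arcOut (L.overPos i)))
    {e e' : L.Arc} (h : L.circleOf σ e = L.circleOf σ e') :
    L.circleOf τ e = L.circleOf τ e' := by
  obtain ⟨w⟩ := SimpleGraph.ConnectedComponent.exact h
  clear h
  induction w with
  | nil => rfl
  | cons hadj _ ih =>
    refine Eq.trans ?_ ih
    rcases L.adj_of_eq_off hστ hadj with h' | ⟨he, he'⟩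
    · exact SimpleGraph.ConnectedComponent.sound h'.reachable
    · have H : ∀ x, L.AtChord i x →
          L.circleOf τ x = L.circleOf τ (L.arcIn (L.overPos i)) := fun x hx ↦
        (L.circleOf_eq_of_atChord τ hx).elim id fun hx' ↦ hx'.trans hτ.symm
      exact (H _ he).trans (H _ he').symm

/-- **The surgery relation between two states agreeing off one chord.** If `σ`, `τ` agree off
chord `i`, the two local strands at `i` lie on different circles of `σ` and on one circle of
`τ`, then the circles of `τ` are those of `σ` with the two circles through the strands united —
the abstract surgery relation `KhFace.Surg` of `KhFaces` (link replacement for the knot tower's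
`IsMergeAt.reachable_update_iff` / `IsSplitAt.reachable_iff` of `KhFlipReach`). Viro (2004),
§5.2 (adjacent states differ by one Morse modification); Bar-Natan (2002), §3.1.
[cite: Viro2004, §5.2] -/
theorem surg_of_eq_off {σ τ : L.State} {i : Fin L.n} (hστ : ∀ j, j ≠ i → τ j = σ j)
    (hσ : L.circleOf σ (L.arcIn (L.overPos i)) ≠ L.circleOf σ (L.arcOut (L.overPos i)))
    (hτ : L.circleOf τ (L.arcIn (L.overPos i)) = L.circleOf τ (L.arcOut (L.overPos i))) :
    KhFace.Surg (L.circleOf σ) (L.circleOf τ) (L.arcIn (L.overPos i))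
      (L.arcOut (L.overPos i)) where
  ne := hσ
  rel x y := by
    refine ⟨fun h ↦ ?_, ?_⟩
    · obtain ⟨p⟩ := SimpleGraph.ConnectedComponent.exact h
      clear h
      induction p with
      | nil => exact Or.inl rfl
      | @cons u v _ hadj _ ih =>
        rcases L.adj_of_eq_off (fun j hj ↦ (hστ j hj).symm) hadj with h' | ⟨hu, hv⟩
        · have huv : L.circleOf σ u = L.circleOf σ v :=
            SimpleGraph.ConnectedComponent.sound h'.reachable
          rw [huv]
          exact ih
        · refine Or.inr ⟨L.circleOf_eq_of_atChord σ hu, ?_⟩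
          rcases ih with h1 | ⟨-, h2⟩
          · rw [← h1]
            exact L.circleOf_eq_of_atChord σ hv
          · exact h2
    · rintro (h | ⟨hx, hy⟩)
      · exact L.circleOf_eq_of_eq_off hστ hτ h
      · have H : ∀ z, (L.circleOf σ z = L.circleOf σ (L.arcIn (L.overPos i)) ∨
            L.circleOf σ z = L.circleOf σ (L.arcOut (L.overPos i))) →
            L.circleOf τ z = L.circleOf τ (L.arcIn (L.overPos i)) := fun z hz ↦
          hz.elim (L.circleOf_eq_of_eq_off hστ hτ) fun hz' ↦
            (L.circleOf_eq_of_eq_off hστ hτ hz').trans hτ.symm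
        exact (H x hx).trans (H y hy).symm

variable {L}

/-- Before a split the two local strands lie on one circle (contrapositive of D2a's
`IsMergeAt.not_isSplitAt`). Viro (2004), §5.2. [cite: Viro2004, §5.2] -/
theorem IsSplitAt.circleOf_arcIn {σ : L.State} {i : Fin L.n} (h : L.IsSplitAt σ i) :
    L.circleOf σ (L.arcIn (L.overPos i)) = L.circleOf σ (L.arcOut (L.overPos i)) := by
  by_contra hne
  exact IsMergeAt.not_isSplitAt ⟨h.1, hne⟩ h

/-- Along a merge edge the circles of `σ[i ↦ 1]` are obtained from those of `σ` by uniting the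
two circles through the local strands, in the form of the abstract surgery relation of
`KhFaces` (port of the knot tower's `GaussDiagram.IsMergeAt.surg`). Viro (2004), §5.2;
Bar-Natan (2002), §3.1. [cite: Viro2004, §5.2] -/
theorem IsMergeAt.surg {σ : L.State} {i : Fin L.n} (h : L.IsMergeAt σ i) :
    KhFace.Surg (L.circleOf σ) (L.circleOf (update σ i true)) (L.arcIn (L.overPos i))
      (L.arcOut (L.overPos i)) :=
  L.surg_of_eq_off (fun _ hj ↦ update_of_ne hj _ _) h.2 h.circleOf_update_arcIn

/-- Along a split edge the circles of `σ` are obtained from those of `σ[i ↦ 1]` by uniting the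
two new circles through the local strands (port of the knot tower's
`GaussDiagram.IsSplitAt.surg`). Viro (2004), §5.2; Bar-Natan (2002), §3.1.
[cite: Viro2004, §5.2] -/
theorem IsSplitAt.surg {σ : L.State} {i : Fin L.n} (h : L.IsSplitAt σ i) :
    KhFace.Surg (L.circleOf (update σ i true)) (L.circleOf σ) (L.arcIn (L.overPos i))
      (L.arcOut (L.overPos i)) :=
  L.surg_of_eq_off (fun _ hj ↦ (update_of_ne hj _ _).symm) h.2 h.circleOf_arcIn

variable (L) in
/-- The **kind** of the edge `σ → σ[i ↦ 1]`: a merge if `IsMergeAt σ i`, a split otherwise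
(meaningful when the edge is a merge or a split). Bar-Natan (2002), §3.1.
[cite: BarNatan2002, §3.1] -/
def kindAt (σ : L.State) (i : Fin L.n) : KhFace.Kind :=
  if L.IsMergeAt σ i then KhFace.Kind.merge else KhFace.Kind.split

/-- A merge-or-split edge satisfies the surgery relation of its kind (stated for any state `τ'`
equal to `σ[i ↦ 1]`, to absorb the order of two commuting updates). [folklore] -/
theorem edgeOK_kindAt {σ τ' : L.State} {i : Fin L.n} (hms : L.IsMergeAt σ i ∨ L.IsSplitAt σ i)
    (hτ' : τ' = update σ i true) :
    KhFace.EdgeOK (L.kindAt σ i) (L.circleOf σ) (L.circleOf τ') (L.arcIn (L.overPos i))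
      (L.arcOut (L.overPos i)) := by
  subst hτ'
  unfold kindAt
  by_cases hm : L.IsMergeAt σ i
  · rw [if_pos hm]
    exact hm.surg
  · rw [if_neg hm]
    exact (hms.resolve_left hm).surg

/-! ## Incidence numbers as signed edge values -/

section Ring

variable {R : Type} [CommRing R]

/-- A nonzero incidence number `⟨d s, x⟩` comes from the flip of a single `0`-smoothing
(`incidence_of_not_flip`). [folklore] -/
theorem exists_of_incidence_ne_zero {h t : R} {s x : L.EnhancedState}
    (h0 : L.incidence R h t s x ≠ 0) :
    ∃ i, s.state i = false ∧ x.state = update s.state i true := by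
  by_contra hne
  exact h0 (incidence_of_not_flip R h t hne)

/-- **Incidence number = Koszul sign × edge value.** Along a merge-or-split edge
`s.state → x.state = s.state[i ↦ 1]`, the incidence number of `LinkKhComplex` is the sign
`edgeSign s.state i` times the abstract edge value of `KhFaces` for the circle maps of the two
states, the labels, and the local strands at chord `i` (`incidence_eq_mergeInc`,
`incidence_eq_splitInc` of D2b). Viro (2004), §5.2. [cite: Viro2004, §5.2] -/
theorem incidence_eq_edgeVal (h t : R) {s x : L.EnhancedState} {i : Fin L.n}
    (hms : L.IsMergeAt s.state i ∨ L.IsSplitAt s.state i)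
    (hx : x.state = update s.state i true) :
    L.incidence R h t s x = (edgeSign s.state i : R) *
      KhFace.edgeVal R h t (L.kindAt s.state i) (L.circleOf s.state) (L.circleOf x.state)
        s.label x.label (L.arcIn (L.overPos i)) (L.arcOut (L.overPos i)) := by
  unfold kindAt
  by_cases hm : L.IsMergeAt s.state i
  · rw [if_pos hm, incidence_eq_mergeInc R h t hm hx]
    rfl
  · rw [if_neg hm, incidence_eq_splitInc R h t (hms.resolve_left hm) hx]
    rfl

end Ring

/-! ## Koszul signs anticommute around a face -/

/-- Flipping the `0`-smoothing at `i` adds `i` to the `1`-smoothings below `j` exactly when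
`i < j`. Khovanov (2000), §3.3. [cite: Khovanov2000, §3.3] -/
theorem card_filter_lt_update {σ : L.State} {i : Fin L.n} (hi : σ i = false) (j : Fin L.n) :
    (univ.filter fun k ↦ k < j ∧ update σ i true k = true).card =
      (univ.filter fun k ↦ k < j ∧ σ k = true).card + if i < j then 1 else 0 := by
  by_cases hij : i < j
  · rw [if_pos hij]
    have hset : (univ.filter fun k ↦ k < j ∧ update σ i true k = true) =
        insert i (univ.filter fun k ↦ k < j ∧ σ k = true) := by
      ext k
      simp only [mem_filter, mem_univ, true_and, mem_insert]
      by_cases hk : k = i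
      · subst hk
        simp [hij]
      · rw [update_of_ne hk]
        simp [hk]
    rw [hset, card_insert_of_notMem (by simp [hi])]
  · rw [if_neg hij, add_zero]
    congr 1
    ext k
    simp only [mem_filter, mem_univ, true_and]
    by_cases hk : k = i
    · subst hk
      simp [hij]
    · rw [update_of_ne hk]

/-- **Koszul signs anticommute.** For two `0`-smoothed chords `i ≠ j` of a state `σ`, the
products of edge signs along the two paths `σ → σ[i↦1] → σ[i↦1][j↦1]` and
`σ → σ[j↦1] → σ[j↦1][i↦1]` are opposite. Khovanov (2000), §3.3 (the skew cube `E_I`);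
Bar-Natan (2002), §3.2. [cite: Khovanov2000, §3.3] -/
theorem edgeSign_mul_edgeSign_update {σ : L.State} {i j : Fin L.n} (hij : i ≠ j)
    (hi : σ i = false) (hj : σ j = false) :
    edgeSign σ i * edgeSign (update σ i true) j =
      -(edgeSign σ j * edgeSign (update σ j true) i) := by
  unfold edgeSign
  rw [card_filter_lt_update hi j, card_filter_lt_update hj i]
  rcases lt_or_gt_of_ne hij with hlt | hlt
  · rw [if_pos hlt, if_neg (not_lt_of_gt hlt)]
    ring
  · rw [if_neg (not_lt_of_gt hlt), if_pos hlt]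
    ring

/-! ## Enhanced states with a fixed state are labellings of its circles -/

variable (L) in
/-- The enhanced state with underlying state `τ` and a labelling of the circles of `τ`
(constant on circles, hence on adjacent arcs). [folklore] -/
abbrev ofLab (τ : L.State) (mu : KhFace.Lab (L.circleOf τ)) : L.EnhancedState :=
  ⟨τ, mu.1, fun a b hab ↦ mu.2 a b (SimpleGraph.ConnectedComponent.sound hab.reachable)⟩

variable (L) in
/-- Enhanced states with underlying state `τ` correspond to labellings of the circles of `τ`.
Viro (2004), §5.1. [cite: Viro2004, §5.1] -/
def stateEquivLab (τ : L.State) :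
    {x : L.EnhancedState // x.state = τ} ≃ KhFace.Lab (L.circleOf τ) where
  toFun x := ⟨x.1.label, fun a b hab ↦ x.1.label_eq_of_circleOf_eq (by rw [x.2]; exact hab)⟩
  invFun mu := ⟨L.ofLab τ mu, rfl⟩
  left_inv x := by
    obtain ⟨⟨st, lbl, hl⟩, hx⟩ := x
    simp only at hx
    subst hx
    rfl
  right_inv _ := rfl

/-- **Summing over the enhanced states with a fixed state** is summing over the labellings of
its circles. [folklore] -/
theorem sum_ite_state_eq {R : Type} [CommRing R] (τ : L.State) (Φ : L.EnhancedState → R) :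
    ∑ x : L.EnhancedState, (if x.state = τ then Φ x else 0) =
      ∑ mu : KhFace.Lab (L.circleOf τ), Φ (L.ofLab τ mu) := by
  classical
  rw [← sum_filter]
  have key : ∑ x ∈ univ.filter (fun x : L.EnhancedState ↦ x.state = τ), Φ x =
      ∑ x : {x : L.EnhancedState // x.state = τ}, Φ x.1 :=
    sum_subtype _ (by simp) Φ
  rw [key]
  refine Fintype.sum_equiv (L.stateEquivLab τ) _ _ fun x ↦ ?_
  obtain ⟨⟨st, lbl, hl⟩, hx⟩ := x
  simp only at hx
  subst hx
  rfl

/-! ## Entries of `d²` vanish -/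

section Ring

variable {R : Type} [CommRing R]

/-- **A face of the cube anticommutes.** If `s'.state` is `s.state` with the two `0`-smoothings
`i ≠ j` flipped, and every edge of the cube is a merge or a split, then
`∑ₓ ⟨d s, x⟩ ⟨d x, s'⟩ = 0`: the two paths of the face contribute the same unsigned sum
(`KhFace.face_comm`) with opposite Koszul signs (`edgeSign_mul_edgeSign_update`).
Khovanov (2000), Prop. 8 and §3.3; Bar-Natan (2002), §3.2. [cite: Khovanov2000, §4.2 Prop. 8] -/
theorem sum_incidence_mul_incidence_face
    (hms : ∀ (σ : L.State) (k : Fin L.n), σ k = false → L.IsMergeAt σ k ∨ L.IsSplitAt σ k)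
    (h t : R) {σ : L.State} {la : L.Arc → Bool}
    {hla : ∀ a b, (L.stateGraph σ).Adj a b → la a = la b} {nu : L.Arc → Bool} {i j : Fin L.n}
    (hij : i ≠ j) (hi : σ i = false) (hj : σ j = false)
    {hnu : ∀ a b, (L.stateGraph (update (update σ i true) j true)).Adj a b → nu a = nu b} :
    ∑ x : L.EnhancedState, L.incidence R h t ⟨σ, la, hla⟩ x *
      L.incidence R h t x ⟨update (update σ i true) j true, nu, hnu⟩ = 0 := by
  classical
  have hσij : update σ i true j = false := by
    rw [update_of_ne (Ne.symm hij), hj]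
  have hσji : update σ j true i = false := by
    rw [update_of_ne hij, hi]
  have hcomm : update (update σ i true) j true = update (update σ j true) i true :=
    update_comm hij true true σ
  have hne : update σ i true ≠ update σ j true := fun h' ↦ by
    have := congrFun h' i
    rw [update_self, hσji] at this
    exact Bool.noConfusion this
  -- Step A: only the two intermediate states of the face contribute
  have hsplit : ∀ x : L.EnhancedState, L.incidence R h t ⟨σ, la, hla⟩ x *
      L.incidence R h t x ⟨update (update σ i true) j true, nu, hnu⟩ =
      (if x.state = update σ i true then L.incidence R h t ⟨σ, la, hla⟩ x *
        L.incidence R h t x ⟨update (update σ i true) j true, nu, hnu⟩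
        else 0) +
      (if x.state = update σ j true then L.incidence R h t ⟨σ, la, hla⟩ x *
        L.incidence R h t x ⟨update (update σ i true) j true, nu, hnu⟩
        else 0) := by
    intro x
    by_cases hxi : x.state = update σ i true
    · rw [if_pos hxi, if_neg (fun hxj ↦ hne (hxi.symm.trans hxj)), add_zero]
    by_cases hxj : x.state = update σ j true
    · rw [if_neg hxi, if_pos hxj, zero_add]
    rw [if_neg hxi, if_neg hxj, add_zero]
    by_cases h1 : L.incidence R h t ⟨σ, la, hla⟩ x = 0
    · rw [h1, zero_mul]
    by_cases h2 : L.incidence R h t x ⟨update (update σ i true) j true, nu, hnu⟩ = 0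
    · rw [h2, mul_zero]
    exfalso
    obtain ⟨k, hk, hxk⟩ := exists_of_incidence_ne_zero h1
    obtain ⟨l, -, hs'l⟩ := exists_of_incidence_ne_zero h2
    simp only at hk hxk hs'l
    -- `k` is a `0`-smoothing of `σ` flipped in `s'`: `k = i` or `k = j`
    have h3 : update (update σ i true) j true k = true := by
      rw [hs'l, hxk]
      by_cases hkl : k = l
      · subst hkl
        rw [update_self]
      · rw [update_of_ne hkl, update_self]
    by_cases hkj : k = j
    · exact hxj (by rw [hxk, hkj])
    · rw [update_of_ne hkj] at h3
      by_cases hki : k = i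
      · exact hxi (by rw [hxk, hki])
      · rw [update_of_ne hki, hk] at h3
        exact Bool.noConfusion h3
  -- Step B: each path is (sign) · (sign) · (abstract face sum)
  have hpath₁ : ∑ x : L.EnhancedState,
      (if x.state = update σ i true then L.incidence R h t ⟨σ, la, hla⟩ x *
        L.incidence R h t x ⟨update (update σ i true) j true, nu, hnu⟩
        else 0) =
      ((edgeSign σ i * edgeSign (update σ i true) j : ℤ) : R) *
        ∑ mu : KhFace.Lab (L.circleOf (update σ i true)),
          KhFace.edgeVal R h t (L.kindAt σ i) (L.circleOf σ)
              (L.circleOf (update σ i true)) la mu.1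
              (L.arcIn (L.overPos i)) (L.arcOut (L.overPos i)) *
            KhFace.edgeVal R h t (L.kindAt (update σ i true) j)
              (L.circleOf (update σ i true))
              (L.circleOf (update (update σ i true) j true)) mu.1 nu
              (L.arcIn (L.overPos j)) (L.arcOut (L.overPos j)) := by
    rw [sum_ite_state_eq, mul_sum]
    refine sum_congr rfl fun mu _ ↦ ?_
    rw [incidence_eq_edgeVal h t (s := ⟨σ, la, hla⟩) (x := L.ofLab _ mu) (i := i) (hms σ i hi)
        rfl,
      incidence_eq_edgeVal h t (s := L.ofLab _ mu)
        (x := ⟨update (update σ i true) j true, nu, hnu⟩) (i := j)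
        (hms _ j hσij) rfl]
    dsimp only [ofLab]
    push_cast
    ring
  have hpath₂ : ∑ x : L.EnhancedState,
      (if x.state = update σ j true then L.incidence R h t ⟨σ, la, hla⟩ x *
        L.incidence R h t x ⟨update (update σ i true) j true, nu, hnu⟩
        else 0) =
      ((edgeSign σ j * edgeSign (update σ j true) i : ℤ) : R) *
        ∑ mu : KhFace.Lab (L.circleOf (update σ j true)),
          KhFace.edgeVal R h t (L.kindAt σ j) (L.circleOf σ)
              (L.circleOf (update σ j true)) la mu.1
              (L.arcIn (L.overPos j)) (L.arcOut (L.overPos j)) *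
            KhFace.edgeVal R h t (L.kindAt (update σ j true) i)
              (L.circleOf (update σ j true))
              (L.circleOf (update (update σ i true) j true)) mu.1 nu
              (L.arcIn (L.overPos i)) (L.arcOut (L.overPos i)) := by
    rw [sum_ite_state_eq, mul_sum]
    refine sum_congr rfl fun mu _ ↦ ?_
    rw [incidence_eq_edgeVal h t (s := ⟨σ, la, hla⟩) (x := L.ofLab _ mu) (i := j) (hms σ j hj)
        rfl,
      incidence_eq_edgeVal h t (s := L.ofLab _ mu)
        (x := ⟨update (update σ i true) j true, nu, hnu⟩) (i := i)
        (hms _ i hσji) hcomm]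
    dsimp only [ofLab]
    push_cast
    ring
  -- Step C: the abstract face theorem and the sign rule
  have hface : ∑ mu : KhFace.Lab (L.circleOf (update σ i true)),
      KhFace.edgeVal R h t (L.kindAt σ i) (L.circleOf σ)
          (L.circleOf (update σ i true)) la mu.1
          (L.arcIn (L.overPos i)) (L.arcOut (L.overPos i)) *
        KhFace.edgeVal R h t (L.kindAt (update σ i true) j)
          (L.circleOf (update σ i true))
          (L.circleOf (update (update σ i true) j true)) mu.1 nu
          (L.arcIn (L.overPos j)) (L.arcOut (L.overPos j)) =
      ∑ mu : KhFace.Lab (L.circleOf (update σ j true)),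
        KhFace.edgeVal R h t (L.kindAt σ j) (L.circleOf σ)
            (L.circleOf (update σ j true)) la mu.1
            (L.arcIn (L.overPos j)) (L.arcOut (L.overPos j)) *
          KhFace.edgeVal R h t (L.kindAt (update σ j true) i)
            (L.circleOf (update σ j true))
            (L.circleOf (update (update σ i true) j true)) mu.1 nu
            (L.arcIn (L.overPos i)) (L.arcOut (L.overPos i)) := by
    -- (`convert`: the `Fintype` instances on labellings found in the abstract and in the
    -- concrete context differ by a `Subsingleton`)
    convert KhFace.face_comm (R := R) (h := h) (t := t) (L.kindAt σ i)
      (L.kindAt (update σ i true) j) (L.kindAt σ j) (L.kindAt (update σ j true) i)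
      (edgeOK_kindAt (hms σ i hi) rfl) (edgeOK_kindAt (hms _ j hσij) rfl)
      (edgeOK_kindAt (hms σ j hj) rfl) (edgeOK_kindAt (hms _ i hσji) hcomm)
      ⟨la, fun a b hab ↦ (⟨σ, la, hla⟩ : L.EnhancedState).label_eq_of_circleOf_eq hab⟩
      ⟨nu, fun a b hab ↦ (⟨update (update σ i true) j true, nu, hnu⟩ :
        L.EnhancedState).label_eq_of_circleOf_eq hab⟩ using 3
  have hsign := congrArg (fun z : ℤ ↦ (z : R)) (edgeSign_mul_edgeSign_update hij hi hj)
  simp only [Int.cast_neg] at hsign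
  rw [sum_congr rfl fun x _ ↦ hsplit x, sum_add_distrib, hpath₁, hpath₂, hface, hsign]
  ring

/-- **Entries of `d²` vanish.** If every edge of the cube of resolutions of `L` is a merge or a
split, then for all enhanced states `s, s'`, `∑ₓ ⟨d s, x⟩ ⟨d x, s'⟩ = 0` (sum over all enhanced
states `x`). Khovanov (2000), Prop. 8; Bar-Natan (2002), §3.2. [cite: Khovanov2000, §4.2 Prop. 8] -/
theorem sum_incidence_mul_incidence_eq_zero
    (hms : ∀ (σ : L.State) (k : Fin L.n), σ k = false → L.IsMergeAt σ k ∨ L.IsSplitAt σ k)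
    (h t : R) (s s' : L.EnhancedState) :
    ∑ x : L.EnhancedState, L.incidence R h t s x * L.incidence R h t x s' = 0 := by
  classical
  obtain ⟨σ, la, hla⟩ := s
  obtain ⟨σ', nu, hnu⟩ := s'
  by_cases hij : ∃ i j : Fin L.n, i ≠ j ∧ σ i = false ∧ σ j = false ∧
      σ' = update (update σ i true) j true
  · obtain ⟨i, j, hne, hi, hj, rfl⟩ := hij
    exact sum_incidence_mul_incidence_face hms h t hne hi hj
  · refine sum_eq_zero fun x _ ↦ ?_
    by_cases h1 : L.incidence R h t ⟨σ, la, hla⟩ x = 0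
    · rw [h1, zero_mul]
    by_cases h2 : L.incidence R h t x ⟨σ', nu, hnu⟩ = 0
    · rw [h2, mul_zero]
    exfalso
    obtain ⟨i, hi, hx⟩ := exists_of_incidence_ne_zero h1
    obtain ⟨j, hj, hs'⟩ := exists_of_incidence_ne_zero h2
    simp only at hi hx hj hs'
    have hne : i ≠ j := by
      rintro rfl
      rw [hx, update_self] at hj
      exact Bool.noConfusion hj
    refine hij ⟨i, j, hne, hi, ?_, ?_⟩
    · rwa [hx, update_of_ne (Ne.symm hne)] at hj
    · rw [hs', hx]

/-- **`d² = 0` from merge-or-split (link Gauss diagrams).** If at every `0`-smoothed chord of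
every state of the link Gauss diagram `L` the flip `0 → 1` is a merge or a split (no
one-to-one bifurcation), the Khovanov differential over `A = R[X]/(X² - hX - t)` squares to
zero. Port of the knot tower's `GaussDiagram.khovanovD_comp_khovanovD_of_isMergeAt_or_isSplitAt`;
the planarity-free content of Khovanov (2000), Prop. 8 (commutativity of the cube `V_D`)
with §3.3–3.4 (the skew cube makes `C(D)` a complex); Bar-Natan (2002), §3.2; Viro (2004),
§5.2. [cite: Khovanov2000, §4.2 Prop. 8] -/
theorem khovanovD_comp_khovanovD_of_isMergeAt_or_isSplitAt (L : LinkGaussDiagram) (R : Type)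
    [CommRing R]
    (hms : ∀ (σ : L.State) (i : Fin L.n), σ i = false → L.IsMergeAt σ i ∨ L.IsSplitAt σ i)
    (h t : R) (i : ℤ) :
    L.khovanovD R h t (i + 1) (i + 1 + 1) ∘ₗ L.khovanovD R h t i (i + 1) = 0 := by
  classical
  rw [khovanovD, khovanovD, ← Matrix.toLin'_mul]
  have hM : ((Matrix.of fun (s' : L.degStates (i + 1 + 1)) (s : L.degStates (i + 1)) ↦
      L.incidence R h t s.1 s'.1) * Matrix.of fun (s' : L.degStates (i + 1))
        (s : L.degStates i) ↦ L.incidence R h t s.1 s'.1) = 0 := by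
    ext s' s
    simp only [Matrix.mul_apply, Matrix.of_apply, Matrix.zero_apply]
    have key : ∑ x ∈ univ.filter (fun x : L.EnhancedState ↦ homDegree x = i + 1),
        L.incidence R h t s.1 x * L.incidence R h t x s'.1 =
        ∑ s'' : L.degStates (i + 1),
          L.incidence R h t s.1 s''.1 * L.incidence R h t s''.1 s'.1 :=
      sum_subtype _ (by simp) fun x ↦ L.incidence R h t s.1 x * L.incidence R h t x s'.1
    calc ∑ s'' : L.degStates (i + 1), L.incidence R h t s''.1 s'.1 * L.incidence R h t s.1 s''.1
        = ∑ s'' : L.degStates (i + 1),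
            L.incidence R h t s.1 s''.1 * L.incidence R h t s''.1 s'.1 :=
          sum_congr rfl fun _ _ ↦ mul_comm _ _
      _ = ∑ x : L.EnhancedState, L.incidence R h t s.1 x * L.incidence R h t x s'.1 := by
          rw [← key, sum_filter]
          refine sum_congr rfl fun x _ ↦ ?_
          by_cases hx : homDegree x = i + 1
          · rw [if_pos hx]
          · rw [if_neg hx]
            by_cases h0 : L.incidence R h t s.1 x = 0
            · rw [h0, zero_mul]
            · exact absurd ((homDegree_eq_of_incidence_ne_zero h0).trans (by rw [s.2])) hx
      _ = 0 := sum_incidence_mul_incidence_eq_zero hms h t s.1 s'.1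
  rw [hM, map_zero]

end Ring

/-! ## Consequences: the complexes of D2b without the hypothesis `hd` -/

/-- Under merge-or-split, `d² = 0` in the form `dᵢ ∘ dᵢ₋₁ = 0` around the degree `i` (the
shape used by `frobeniusHomology = ker dᵢ ⧸ (im dᵢ₋₁ ⊓ ker dᵢ)`). Khovanov (2000), Prop. 8.
[cite: Khovanov2000, §4.2 Prop. 8] -/
theorem khovanovD_comp_khovanovD_pred_of_isMergeAt_or_isSplitAt (L : LinkGaussDiagram)
    (R : Type) [CommRing R]
    (hms : ∀ (σ : L.State) (i : Fin L.n), σ i = false → L.IsMergeAt σ i ∨ L.IsSplitAt σ i)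
    (h t : R) (i : ℤ) :
    L.khovanovD R h t i (i + 1) ∘ₗ L.khovanovD R h t (i - 1) i = 0 := by
  have := khovanovD_comp_khovanovD_of_isMergeAt_or_isSplitAt L R hms h t (i - 1)
  rwa [sub_add_cancel] at this

/-- Under merge-or-split, **boundaries are cycles**: `im dᵢ₋₁ ≤ ker dᵢ`, so that D2b's concrete
`frobeniusHomology R h t i` is the honest homology `ker dᵢ ⧸ im dᵢ₋₁`. Khovanov (2000), §7,
Prop. 8. [cite: Khovanov2000, §4.2 Prop. 8] -/
theorem range_khovanovD_le_ker (L : LinkGaussDiagram) (R : Type) [CommRing R]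
    (hms : ∀ (σ : L.State) (i : Fin L.n), σ i = false → L.IsMergeAt σ i ∨ L.IsSplitAt σ i)
    (h t : R) (i : ℤ) :
    LinearMap.range (L.khovanovD R h t (i - 1) i) ≤
      LinearMap.ker (L.khovanovD R h t i (i + 1)) :=
  LinearMap.range_le_ker_iff.mpr
    (khovanovD_comp_khovanovD_pred_of_isMergeAt_or_isSplitAt L R hms h t i)

/-- **The Khovanov cochain complex of a link Gauss diagram satisfying merge-or-split**, over
`A = R[X]/(X² - hX - t)`: D2b's `frobeniusComplex` with its hypothesis `hd` (`d² = 0`)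
discharged by `khovanovD_comp_khovanovD_of_isMergeAt_or_isSplitAt`. Khovanov (2000), §4.2,
§7, Prop. 8; Khovanov (2006), §2. [cite: Khovanov2000, §4.2 Prop. 8] -/
abbrev frobeniusComplexOfDichotomy (L : LinkGaussDiagram) (R : Type) [CommRing R]
    (hms : ∀ (σ : L.State) (i : Fin L.n), σ i = false → L.IsMergeAt σ i ∨ L.IsSplitAt σ i)
    (h t : R) : CochainComplex (ModuleCat R) ℤ :=
  L.frobeniusComplex R h t (khovanovD_comp_khovanovD_of_isMergeAt_or_isSplitAt L R hms h t)

/-- **Lee's cochain complex of a link Gauss diagram satisfying merge-or-split**: D2b's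
`leeComplex` (`(ℚ, 0, 1)`) with its hypothesis `hd` discharged. Lee (2005), §4; Rasmussen
(2010), §2.1. [cite: Lee2005, §4] -/
abbrev leeComplexOfDichotomy (L : LinkGaussDiagram)
    (hms : ∀ (σ : L.State) (i : Fin L.n), σ i = false → L.IsMergeAt σ i ∨ L.IsSplitAt σ i) :
    CochainComplex (ModuleCat ℚ) ℤ :=
  L.leeComplex (khovanovD_comp_khovanovD_of_isMergeAt_or_isSplitAt L ℚ hms 0 1)

/-! ## The concrete homology of D2b is the categorical homology of `frobeniusComplex`

Port of `GaussDiagram.nonempty_iso_frobeniusHomology_homology_holds` (`KhComplexProofs`):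
pure Mathlib plumbing (`CochainComplex.of_d`, `HomologicalComplex.homologyIsoSc'`,
`ShortComplex.moduleCatHomologyIso`, `Submodule.quotEquivOfEq`), valid for every proof `hd` of
`d² = 0`, in particular for the one from merge-or-split. -/

section Homology

open CategoryTheory

variable (L : LinkGaussDiagram) (R : Type) [CommRing R]

/-- Every differential of D2b's cochain complex `frobeniusComplex` (a `CochainComplex.of`) is
the incidence matrix `khovanovD` between the corresponding degrees: on the nose for
`j = i + 1` (`CochainComplex.of_d`), and both sides vanish otherwise (`CochainComplex.of_d_ne`,
`khovanovD_eq_zero_of_ne`). Mathlib plumbing for Khovanov (2000), §7. [cite: Khovanov2000, §7] -/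
theorem frobeniusComplex_d (h t : R)
    (hd : ∀ i : ℤ, L.khovanovD R h t (i + 1) (i + 1 + 1) ∘ₗ L.khovanovD R h t i (i + 1) = 0)
    (i j : ℤ) :
    (L.frobeniusComplex R h t hd).d i j = ModuleCat.ofHom (L.khovanovD R h t i j) := by
  change CochainComplex.of.d (fun i ↦ ModuleCat.of R (L.degStates i → R))
      (fun i ↦ ModuleCat.ofHom (L.khovanovD R h t i (i + 1))) i j = _
  by_cases hij : i + 1 = j
  · subst hij
    exact CochainComplex.of_d _ _ i
  · rw [CochainComplex.of_d_ne _ _ hij, L.khovanovD_eq_zero_of_ne R h t (Ne.symm hij)]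
    exact ModuleCat.ofHom_zero.symm

/-- **The concrete homology is the categorical homology.** For every proof `hd` of `d² = 0`,
D2b's subquotient `frobeniusHomology R h t i = ker dᵢ ⧸ (im dᵢ₋₁ ⊓ ker dᵢ)` is isomorphic to
the homology of the cochain complex `frobeniusComplex R h t hd` in degree `i`:
`HomologicalComplex.homologyIsoSc'` computes the latter from the short complex
`C^{i-1} → Cⁱ → C^{i+1}`, isomorphic (`ShortComplex.isoMk`, `frobeniusComplex_d`) to
`ShortComplex.moduleCatMk (khovanovD (i-1) i) (khovanovD i (i+1))`, whose homology
`ShortComplex.moduleCatHomologyIso` identifies with `ker dᵢ ⧸ range (dᵢ₋₁ → ker dᵢ)`; the two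
denominators agree (`Submodule.quotEquivOfEq`). Port of the knot tower's
`nonempty_iso_frobeniusHomology_homology_holds`. Khovanov (2000), §7. [cite: Khovanov2000, §7] -/
theorem nonempty_iso_frobeniusHomology_homology (h t : R)
    (hd : ∀ i : ℤ, L.khovanovD R h t (i + 1) (i + 1 + 1) ∘ₗ L.khovanovD R h t i (i + 1) = 0)
    (i : ℤ) :
    Nonempty (L.frobeniusHomology R h t i ≅ (L.frobeniusComplex R h t hd).homology i) := by
  -- `d² = 0` between the degrees `i - 1`, `i`, `i + 1`
  have hfg : L.khovanovD R h t i (i + 1) ∘ₗ L.khovanovD R h t (i - 1) i = 0 := by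
    have := hd (i - 1)
    rwa [sub_add_cancel] at this
  -- the model short complex of modules
  let S₀ : ShortComplex (ModuleCat R) :=
    ShortComplex.moduleCatMk (L.khovanovD R h t (i - 1) i) (L.khovanovD R h t i (i + 1)) hfg
  -- the short complex of `frobeniusComplex` around `i` is the model one
  let eS : (L.frobeniusComplex R h t hd).sc' (i - 1) i (i + 1) ≅ S₀ :=
    ShortComplex.isoMk (Iso.refl _) (Iso.refl _) (Iso.refl _)
      (by
        simp [S₀, frobeniusComplex_d]
        exact (Category.id_comp _).trans (Category.comp_id _).symm)
      (by
        simp [S₀, frobeniusComplex_d]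
        exact (Category.id_comp _).trans (Category.comp_id _).symm)
  have e₁ : (L.frobeniusComplex R h t hd).homology i ≅
      ((L.frobeniusComplex R h t hd).sc' (i - 1) i (i + 1)).homology :=
    (L.frobeniusComplex R h t hd).homologyIsoSc' (i - 1) i (i + 1)
      (CochainComplex.prev ℤ i) (CochainComplex.next ℤ i)
  have e₂ : ((L.frobeniusComplex R h t hd).sc' (i - 1) i (i + 1)).homology ≅ S₀.homology :=
    ShortComplex.homologyMapIso eS
  have e₃ : S₀.homology ≅ S₀.moduleCatLeftHomologyData.H := S₀.moduleCatHomologyIso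
  -- the two denominators agree as submodules of `ker dᵢ`
  have hrange : LinearMap.range S₀.moduleCatToCycles =
      (LinearMap.range (L.khovanovD R h t (i - 1) i)).comap
        (LinearMap.ker (L.khovanovD R h t i (i + 1))).subtype := by
    ext ⟨x, hx⟩
    simp only [LinearMap.mem_range]
    constructor
    · rintro ⟨y, hy⟩
      exact ⟨y, congrArg Subtype.val hy⟩
    · rintro ⟨y, hy⟩
      exact ⟨y, Subtype.ext hy⟩
  have e₄ : S₀.moduleCatLeftHomologyData.H ≅ L.frobeniusHomology R h t i :=
    (Submodule.quotEquivOfEq _ _ hrange).toModuleIso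
  exact ⟨(e₁ ≪≫ e₂ ≪≫ e₃ ≪≫ e₄).symm⟩

/-- **Under merge-or-split the concrete homology is the homology of the Khovanov complex**
`frobeniusComplexOfDichotomy` (so D2b's `leeHomology`, `LeeHomologyZero`, `rasmussenInvariant`
of such a link diagram are computed by an honest cochain complex). Khovanov (2000), §7,
Prop. 8. [cite: Khovanov2000, §7] -/
theorem nonempty_iso_frobeniusHomology_homology_of_isMergeAt_or_isSplitAt
    (hms : ∀ (σ : L.State) (i : Fin L.n), σ i = false → L.IsMergeAt σ i ∨ L.IsSplitAt σ i)
    (h t : R) (i : ℤ) :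
    Nonempty (L.frobeniusHomology R h t i ≅
      (frobeniusComplexOfDichotomy L R hms h t).homology i) :=
  nonempty_iso_frobeniusHomology_homology L R h t _ i

end Homology

/-! ## Sanity: the crossingless diagrams, and transport from the knot tower -/

/-- The crossingless diagrams `unknots k` satisfy merge-or-split vacuously (no chord).
[folklore] -/
theorem isMergeAt_or_isSplitAt_unknots (k : ℕ) :
    ∀ (σ : (unknots k).State) (i : Fin (unknots k).n), σ i = false →
      (unknots k).IsMergeAt σ i ∨ (unknots k).IsSplitAt σ i :=
  fun _ i _ ↦ i.elim0

/-- Hence `d² = 0` for the Khovanov complex of the crossingless `k`-component unlink diagram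
(all its differentials vanish anyway: every enhanced state has homological degree `0`).
Khovanov (2000), §4.2. [cite: Khovanov2000, §4.2] -/
theorem khovanovD_comp_khovanovD_unknots (k : ℕ) (R : Type) [CommRing R] (h t : R) (i : ℤ) :
    (unknots k).khovanovD R h t (i + 1) (i + 1 + 1) ∘ₗ (unknots k).khovanovD R h t i (i + 1) =
      0 :=
  khovanovD_comp_khovanovD_of_isMergeAt_or_isSplitAt _ R (isMergeAt_or_isSplitAt_unknots k) h t i

/-- **Transport of the dichotomy from the knot tower.** If the knot Gauss diagram `G` satisfies
Gauss's parity condition (every chord joins marked points of opposite parity — automatic for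
diagrams of knots, `Knot.RegularProjection.overPos_mod_two_ne_underPos_mod_two`), then every
edge of the cube of the link diagram `ofGaussDiagram G` is a merge or a split: the knot tower's
`GaussDiagram.isMergeAt_or_isSplitAt_of_overPos_mod_two_ne` (`KhResolutionsDichotomyProofs`)
carried over by D2a's `isMergeAt_ofGaussDiagram_iff` / `isSplitAt_ofGaussDiagram_iff` (for
`G.n = 0` there is no chord and nothing to prove). Viro (2004), §5.2. [cite: Viro2004, §5.2] -/
theorem isMergeAt_or_isSplitAt_ofGaussDiagram (G : GaussDiagram)
    (hpar : ∀ j : Fin G.n, (G.overPos j).val % 2 ≠ (G.underPos j).val % 2) :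
    ∀ (σ : (ofGaussDiagram G).State) (i : Fin (ofGaussDiagram G).n), σ i = false →
      (ofGaussDiagram G).IsMergeAt σ i ∨ (ofGaussDiagram G).IsSplitAt σ i := by
  intro σ i hσ
  have hG : G.n ≠ 0 := (Fin.pos i).ne'
  rcases GaussDiagram.isMergeAt_or_isSplitAt_of_overPos_mod_two_ne (G := G) (σ := σ) (i := i)
      hpar hσ with hm | hs
  · exact Or.inl ((isMergeAt_ofGaussDiagram_iff G hG σ i).2 hm)
  · exact Or.inr ((isSplitAt_ofGaussDiagram_iff G hG σ i).2 hs)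

/-- **`d² = 0` on the image of the knot tower, under Gauss parity**: for a knot Gauss diagram
`G` whose chords join points of opposite parity, the Khovanov differential of the link diagram
`ofGaussDiagram G` squares to zero (consistent, through D2b's `khovanovD_comp_funCongrLeft`,
with the knot tower's `khovanovD_comp_khovanovD_holds`). Khovanov (2000), Prop. 8.
[cite: Khovanov2000, §4.2 Prop. 8] -/
theorem khovanovD_comp_khovanovD_ofGaussDiagram (G : GaussDiagram) (R : Type) [CommRing R]
    (hpar : ∀ j : Fin G.n, (G.overPos j).val % 2 ≠ (G.underPos j).val % 2) (h t : R)
    (i : ℤ) :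
    (ofGaussDiagram G).khovanovD R h t (i + 1) (i + 1 + 1) ∘ₗ
        (ofGaussDiagram G).khovanovD R h t i (i + 1) = 0 :=
  khovanovD_comp_khovanovD_of_isMergeAt_or_isSplitAt _ R
    (isMergeAt_or_isSplitAt_ofGaussDiagram G hpar) h t i

end LinkGaussDiagram

end Literature.Topology.FourManifolds
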